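import Summits.CriticalPhenomena.PercolationContinuityZ3.Theorems.SahiMasterFamilyPhiOrbit
import Summits.CriticalPhenomena.PercolationContinuityZ3.Theorems.SahiMasterFamilyUpperMaster

/-!
# The orbit-basis certificate check for the UPPER master inequality `U(n)` (`UpperMaster.PhiLeTopGap n`)

Unit `prim-masterthm-p4` (gen 13; crux anchor stmt-CriticalPhenomena-4575, helper work; memo
`run/shared/lean/prim/prim-masterthm/prim-masterthm-p4/P4-GEN13-REPORT.md` §6, §9–§10).  Companion of `…PhiOrbit` (orbit basis for `F(n)`).
`U(n)`: `Φ_n(β) ≤ (n−1)!·(β_⊤ − ∏_i β_i)` for every nonnegative supermultiplicative `β` (NO normalisation of `β_⊤`, no upper bound).  The LP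
certificates (kit j124697 for `n = 5, 6`, kit j124718 for `n = 7, 8`) have the shape
`(n−1)!(x_⊤ − ∏x_i) − Φ_n = (1/n!) Σ_{g∈S_n} Σ_t c_t g·∏atoms_t` with atoms `b_S = β_S` and merge gaps `h(S;A,B) = β_S − β_Aβ_B` only.
This file adapts the checker: monomials WITHOUT the substitution `β_⊤ ↦ 1` (`monoV`, `symEV`, `atomPolyV`, `termsPolyNV`), the target
`targetU n = (n−1)!·x_⊤ − (n−1)!·∏x_i − Φ_n` (`evalP_targetU`), its symmetry under relabelling, and
`phiLeTopGap_of_orbitPiecesU` — from the kernel-evaluated pieces to `PhiLeTopGap (n+1)`.  Data files: `…PhiOrbitUpperSeven` (and higher).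
HONEST FRAMING: infrastructure for an UPPER bound; Sahi's lower bound `C_n` is a different matter.  Axioms standard. [this work]
-/

set_option autoImplicit false

namespace Summit.CriticalPhenomena.PercolationContinuityZ3.Theorems

namespace PhiCert

open Finset Literature.Combinatorics.Sahi2008
open PrincipalCapBeta (realF realW)

/-! ## Syntax without the top substitution -/

/-- The monomial `β_S` (no substitution of the top value). [this work] -/
def monoV (S : ℕ) : Poly := [([S], 1)]

/-- `monoV` evaluates to `β_S`. [this work] -/
theorem evalP_monoV (v : ℕ → ℝ) (S : ℕ) : evalP v (monoV S) = v S := by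
  rw [monoV, evalP, evalP, evalM, evalM]; push_cast; ring

/-- The symbolic Lieb–Sahi recursion without top substitution, normalised at every level. [this work] -/
def symEV : (m : ℕ) → (Fin m → ℕ) → Poly
  | 0, _ => []
  | 1, L => monoV (L 0)
  | m + 2, L =>
      normP ((List.finRange (m + 1)).foldr
          (fun i acc => symEV (m + 1) (Function.update (Fin.tail L) i (Fin.tail L i ||| L 0)) ++ acc) []
        ++ scaleP (-1) (mulP (symEV (m + 1) (Fin.tail L)) (monoV (L 0))))

section ModelV

variable {n : ℕ}

/-- **Soundness of `symEV`** (any `β`, no normalisation): `evalP (symEV m L) = E_m(realW β; ∏_{j∈L i} realF j)`. [this work] -/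
theorem symEV_sound (β : Finset (Fin n) → ℝ) :
    ∀ (m : ℕ) (L : Fin m → ℕ), evalP (val β) (symEV m L) = sahiE (realW β) m (fam L)
  | 0, L => by rw [symEV, evalP, sahiE_zero]
  | 1, L => by
    rw [symEV, evalP_monoV, sahiE_one_apply, fam, val, PrincipalCapBeta.ex_realW_prod]
  | m + 2, L => by
    rw [symEV, evalP_normP, evalP_append, evalP_foldr, evalP_scaleP, evalP_mulP, evalP_monoV, symEV_sound β (m + 1),
      sahiE_succ_succ, ← Fin.sum_univ_def]
    have htail : fam (Fin.tail L) = Fin.tail (fam L : Fin (m + 2) → Finset (Fin n) → ℝ) := rfl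
    have hupd : ∀ i : Fin (m + 1), fam (Function.update (Fin.tail L) i (Fin.tail L i ||| L 0)) =
        Function.update (Fin.tail (fam L : Fin (m + 2) → Finset (Fin n) → ℝ)) i (Fin.tail (fam L) i * fam L 0) := by
      intro i
      funext j
      by_cases hj : j = i
      · subst hj
        rw [Function.update_self, fam, Function.update_self, ofMask_or, ← prod_realF_mul]; rfl
      · rw [Function.update_of_ne hj, fam, Function.update_of_ne hj]; rfl
    have h0 : val β (L 0) = ex (realW β) (fam L 0) := by rw [fam, PrincipalCapBeta.ex_realW_prod]; rfl
    rw [htail, h0, sum_congr rfl fun i _ => by rw [symEV_sound β (m + 1), hupd i]]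
    push_cast; ring

/-- `symEV` of the singleton masks is `Φ_n` (no hypothesis on `β`). [this work] -/
theorem evalP_symEV_singletons (β : Finset (Fin (n + 1)) → ℝ) :
    evalP (val β) (symEV (n + 1) fun i => 2 ^ (i : ℕ)) = PrincipalCapBeta.phiSet (n + 1) β := by
  rw [symEV_sound β, PrincipalCapBeta.phiSet_eq_sahiE_real]
  congr 1
  funext i
  rw [fam, ofMask_two_pow, prod_singleton]

end ModelV

/-! ## Atoms without substitution; the certificate polynomial -/

/-- Atom polynomials without top substitution. [this work] -/
def atomPolyV : Atom → Poly
  | .b S => monoV S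
  | .d S => ([], 1) :: scaleP (-1) (monoV S)
  | .h S A B => monoV S ++ scaleP (-1) (mulP (monoV A) (monoV B))

/-- `atomPolyV` evaluates to `atomVal`. [this work] -/
theorem evalP_atomPolyV (v : ℕ → ℝ) (a : Atom) : evalP v (atomPolyV a) = atomVal v a := by
  cases a with
  | b S => rw [atomPolyV, atomVal, evalP_monoV]
  | d S => rw [atomPolyV, atomVal, evalP, evalP_scaleP, evalP_monoV, evalM]; push_cast; ring
  | h S A B => rw [atomPolyV, atomVal, evalP_append, evalP_scaleP, evalP_mulP, evalP_monoV, evalP_monoV, evalP_monoV]; push_cast; ring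

/-- Well-formedness for `U(n)`: only `b` and exact `h` atoms (no `d`: there is no upper bound on `β`). [this work] -/
def Atom.wfU : Atom → Bool
  | .b _ => true
  | .d _ => false
  | .h S A B => (A ||| B) == S

/-- Atoms allowed for `U(n)` are nonnegative under `β ≥ 0` and supermultiplicativity. [this work] -/
theorem atomVal_nonneg_U {n : ℕ} (β : Finset (Fin n) → ℝ) (h0 : ∀ B, 0 ≤ β B) (hsup : ∀ S T, β S * β T ≤ β (S ∪ T))
    (a : Atom) (ha : a.wfU = true) : 0 ≤ atomVal (val β) a := by
  cases a with
  | b S => exact h0 _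
  | d S => exact absurd ha (by simp [Atom.wfU])
  | h S A B =>
    have hS : A ||| B = S := by simpa [Atom.wfU] using ha
    rw [atomVal, sub_nonneg, val, val, val, ← hS, ofMask_or]
    exact hsup _ _

/-- Product polynomial without substitution. [this work] -/
def prodPV : List Atom → Poly
  | [] => [([], 1)]
  | a :: as => mulP (atomPolyV a) (prodPV as)

/-- `prodPV` evaluates to the product. [this work] -/
theorem evalP_prodPV (v : ℕ → ℝ) : ∀ as : List Atom, evalP v (prodPV as) = (as.map (atomVal v)).prod
  | [] => by rw [prodPV, evalP, evalP, evalM, List.map_nil, List.prod_nil]; push_cast; ring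
  | a :: as => by rw [prodPV, evalP_mulP, evalP_atomPolyV, evalP_prodPV v as, List.map_cons, List.prod_cons]

/-- Weighted products, each normalised. [this work] -/
def termsPolyNV : List (ℤ × List Atom) → Poly
  | [] => []
  | t :: T => normP (scaleP t.1 (prodPV t.2)) ++ termsPolyNV T

/-- Data check for `U(n)` certificates. [this work] -/
def checkTU : List (ℤ × List Atom) → Bool
  | [] => true
  | t :: T => (decide (0 ≤ t.1) && t.2.all Atom.wfU) && checkTU T

/-- `termsPolyNV` is nonnegative on the constraint set of `U(n)`. [this work] -/
theorem termsPolyNV_nonneg {n : ℕ} (β : Finset (Fin n) → ℝ) (h0 : ∀ B, 0 ≤ β B) (hsup : ∀ S T, β S * β T ≤ β (S ∪ T)) :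
    ∀ T : List (ℤ × List Atom), checkTU T = true → 0 ≤ evalP (val β) (termsPolyNV T)
  | [], _ => by rw [termsPolyNV, evalP]
  | t :: T, hT => by
    rw [checkTU, Bool.and_eq_true, Bool.and_eq_true] at hT
    obtain ⟨⟨hw, hwf⟩, hT'⟩ := hT
    rw [termsPolyNV, evalP_append, evalP_normP, evalP_scaleP, evalP_prodPV]
    refine add_nonneg (mul_nonneg (by exact_mod_cast of_decide_eq_true hw) (List.prod_nonneg fun x hx => ?_))
      (termsPolyNV_nonneg β h0 hsup T hT')
    obtain ⟨a, ha, rfl⟩ := List.mem_map.1 hx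
    exact atomVal_nonneg_U β h0 hsup a (List.all_eq_true.1 hwf a ha)

/-! ## The target `(n−1)!·x_⊤ − (n−1)!·∏ x_i − Φ_n` -/

/-- The list of singleton masks `[2^0, …, 2^(n−1)]` (a sorted monomial). [this work] -/
def singletonsMono (n : ℕ) : Mono := (List.finRange n).map fun i : Fin n => 2 ^ i.val

/-- The target polynomial of `U(n)`: `(n−1)!·x_⊤ − (n−1)!·∏_i x_i − Φ_n`. [this work] -/
def targetU (n : ℕ) : Poly :=
  [([2 ^ n - 1], ((n - 1).factorial : ℤ)), (singletonsMono n, -((n - 1).factorial : ℤ))] ++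
    scaleP (-1) (symEV n fun i : Fin n => 2 ^ (i : ℕ))

section Target

variable {n : ℕ}

/-- The singleton monomial evaluates to `∏_i β {i}`. [this work] -/
theorem evalM_singletonsMono (β : Finset (Fin n) → ℝ) : evalM (val β) (singletonsMono n) = ∏ i : Fin n, β {i} := by
  rw [evalM_eq_prod, singletonsMono, List.map_map, Fin.prod_univ_def]
  congr 1
  apply List.map_congr_left
  intro i _
  show val β (2 ^ i.val) = β {i}
  rw [val, ofMask_two_pow]

/-- **The target evaluates to `n!·(β_⊤ − ∏_i β_i) − Φ_{n+1}(β)`.** [this work] -/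
theorem evalP_targetU (β : Finset (Fin (n + 1)) → ℝ) :
    evalP (val β) (targetU (n + 1)) =
      (n.factorial : ℝ) * (β univ - ∏ i, β {i}) - PrincipalCapBeta.phiSet (n + 1) β := by
  have htop : val β (2 ^ (n + 1) - 1) = β univ := by rw [val, ofMask_full]
  rw [targetU, evalP_append, evalP, evalP, evalP, evalP_scaleP, evalP_symEV_singletons, evalM, evalM, evalM_singletonsMono,
    htop, Nat.add_sub_cancel]
  push_cast
  ring

/-- The target is invariant under relabelling. [this work] -/
theorem evalP_targetU_actV (σ : Equiv.Perm (Fin (n + 1))) (β : Finset (Fin (n + 1)) → ℝ) :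
    evalP (val (actV σ β)) (targetU (n + 1)) = evalP (val β) (targetU (n + 1)) := by
  rw [evalP_targetU, evalP_targetU, actV_univ, phiSet_actV]
  congr 3
  have e : ∀ i : Fin (n + 1), actV σ β {i} = β {σ i} := fun i => by
    unfold actV; rw [Finset.map_singleton]; rfl
  simp only [e]
  exact Fintype.prod_equiv σ _ _ fun i => rfl

end Target


/-! ## Decoders with a general base (masks of `n ≥ 8` coordinates need base `2^n`) -/

/-- Decode an orbit-data entry with monomials in base `b`. [this work] -/
def decodeDb (b n : ℕ) (e : ℤ × ℕ × ℕ) : ℤ × List ℕ × Mono :=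
  (e.1, digitsFix 8 n e.2.1, digitsVar b n e.2.2)

/-- Decode a normal-form entry with monomials in base `b`. [this work] -/
def decodeRb (b n : ℕ) (e : ℕ × ℤ) : Mono × ℤ :=
  (digitsVar b n e.1, e.2)

/-! ## The orbit-basis check for `U(n)` and its soundness -/

section SoundU

variable {n : ℕ}

/-- **REFLECTION FOR `U(n)`, ORBIT BASIS, IN PIECES.** [this work] -/
theorem phiLeTopGap_of_orbitPiecesU (n M : ℕ) (hM : 0 < M) (C : List (ℤ × List Atom)) (D : List (ℤ × List ℕ × Mono)) (RD : Poly)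
    (hT : checkTU C = true) (hDZ : checkDZ (n + 1) D = true)
    (hR : normP (termsPolyNV C ++ scaleP (-(M : ℤ)) (targetU (n + 1))) = RD)
    (hrec : D.map (recon (n + 1)) = RD) :
    UpperMaster.PhiLeTopGap (n + 1) := by
  intro β h0 hsup
  rw [checkDZ, Bool.and_eq_true, decide_eq_true_eq] at hDZ
  obtain ⟨hD, hzero⟩ := hDZ
  set R : Poly := termsPolyNV C ++ scaleP (-(M : ℤ)) (targetU (n + 1)) with hRdef
  have hR0 : evalSym β R = 0 := by
    rw [← evalSym_normP, hR, ← hrec, evalSym_recon β D hD, ← evalSym_normP, hzero]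
    simp [evalSym, evalP]
  have hRσ : ∀ σ : Equiv.Perm (Fin (n + 1)), evalP (val (actV σ β)) R =
      evalP (val (actV σ β)) (termsPolyNV C) - (M : ℝ) * evalP (val β) (targetU (n + 1)) := by
    intro σ
    rw [hRdef, evalP_append, evalP_scaleP, evalP_targetU_actV]
    push_cast
    ring
  have hsum : evalSym β R = (∑ σ : Equiv.Perm (Fin (n + 1)), evalP (val (actV σ β)) (termsPolyNV C)) -
      ((Nat.factorial (n + 1) : ℕ) : ℝ) * ((M : ℝ) * evalP (val β) (targetU (n + 1))) := by
    unfold evalSym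
    rw [Finset.sum_congr rfl fun σ _ => hRσ σ, Finset.sum_sub_distrib, Finset.sum_const, Finset.card_univ,
      Fintype.card_perm, Fintype.card_fin, nsmul_eq_mul]
  have hQ : 0 ≤ ∑ σ : Equiv.Perm (Fin (n + 1)), evalP (val (actV σ β)) (termsPolyNV C) :=
    Finset.sum_nonneg fun σ _ => termsPolyNV_nonneg (actV σ β) (fun B => h0 _) (actV_supermul σ β hsup) C hT
  have hfac : (0 : ℝ) < ((Nat.factorial (n + 1) : ℕ) : ℝ) := by exact_mod_cast Nat.factorial_pos (n + 1)
  have hM' : (0 : ℝ) < (M : ℝ) := by exact_mod_cast hM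
  have key : ((Nat.factorial (n + 1) : ℕ) : ℝ) * ((M : ℝ) * evalP (val β) (targetU (n + 1))) =
      ∑ σ : Equiv.Perm (Fin (n + 1)), evalP (val (actV σ β)) (termsPolyNV C) := by
    linarith [hsum, hR0]
  have h3 : 0 ≤ (M : ℝ) * evalP (val β) (targetU (n + 1)) := (mul_nonneg_iff_of_pos_left hfac).1 (key ▸ hQ)
  have h4 : 0 ≤ evalP (val β) (targetU (n + 1)) := (mul_nonneg_iff_of_pos_left hM').1 h3
  rw [evalP_targetU] at h4
  show PrincipalCapBeta.phiSet (n + 1) β ≤ ((n + 1 - 1).factorial : ℝ) * (β univ - ∏ i, β {i})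
  rw [Nat.add_sub_cancel]
  linarith [h4]

end SoundU

end PhiCert

end Summit.CriticalPhenomena.PercolationContinuityZ3.Theorems
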